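import Literature.Computability.QuantumComplexity.AaronsonAmbainisThm23Queries
import Literature.Computability.QuantumComplexity.PolynomialMethod
import Literature.Computability.Cryptography.QubitRegisterProofs
import Summits.QuantumAdvantage.QuantumAdvantage.Theorems.WbwVerifiableLineNoSpeedup.Negative.QueryReindex
import HarnessLib

/-!
# The circuit→query bridge: an oracle circuit IS a quantum query algorithm on the relevant oracle bits

Support theorem for route `SosSandwich` (crux `PseudoBoundedAA`, stmt-QuantumAdvantage-15237), item (1) "[M–L] circuit→query
bridge" of the repair census in `Theorems/SosSandwichTransferPBPathBoundChainFinal.lean`: the summit assembly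
`quantumAdvantage_of_pathBound` needs the Aaronson–Ambainis influence bound only for (restrictions of) the acceptance
polynomials `acceptPoly F x` of ORACLE CIRCUITS; here every such polynomial is shown to be, on the cube, the acceptance
probability of a quantum QUERY algorithm of the tree's Beals et al. model (`QQueryAlg`, `Cryptography/QuantumQuery.lean`)
with exactly `#oracle gates` queries (`familyAlg_acceptProb`, `familyAlg_queries`, `exists_queryAlg_acceptPoly`) — so the
route's analytic crux may be taken to be the AA conjecture for quantum query algorithms (sequel `…TransferPBQueryCrux.lean`).

Construction (Bernstein–Vazirani §8 / Nielsen–Chuang §6.1: "an oracle gate is a query"): basis `Fin N × Bool × QReg Wd`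
(index register, target qubit, the circuit's wires), circuit state embedded at `(i₀, false, ·)` (`emb`; `lift`/`extU` of
`QueryReindex.lean`); oracle `A` and query input `t` COMPATIBLE along `adr : OracleVar Wd → Fin N` when `[q ∈ A] = t (adr q)`.
An oracle-free gate acts as its placement (`gateU`); an oracle gate with answer wire `τ` becomes `adrMap` (load
`swap i₀ (adr (query string))` into the index register) · `swapMap` (target ↔ wire `τ`) · ONE QUERY · `swapMap` · `adrMap`
(`oracle_conj`).  The unitaries between queries are accumulated in an `ℕ`-indexed program (`Prog.step`, `progOf`, `run`)
with invariant `inv_progOf` (program state = embedded circuit state), whence `circuitAlg_queries` and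
`circuitAlg_acceptProb`.  Any unitary gate set; sorry-free; no named fact.  Generic — a librarian may relocate it next to
`Literature/Computability/QuantumComplexity/OraclePolynomialMethod.lean`.
Sources: BernsteinVazirani1997 §8; BealsEtAl2001 §2; AaronsonAmbainis2014 Lemma 20 / proof of Thm. 23 (p. 14).
-/

noncomputable section
-- D-0017: single-conjunct summit ⇒ the duplicate `QuantumAdvantage.QuantumAdvantage` is mandated.
set_option linter.dupNamespace false

namespace Summit.QuantumAdvantage.QuantumAdvantage.Theorems.SosSandwich.CircuitToQuery

open Matrix Literature.Computability.Cryptography Literature.Computability.QuantumComplexity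
open Summit.QuantumAdvantage.QuantumAdvantage.Theorems.WbwVerifiableLineNoSpeedup.Negative.QueryReindex

/-! ### Running an `ℕ`-indexed program of unitaries interleaved with queries -/

section Run
variable {S : Type} [Fintype S]

/-- `run T U O v`: apply `U 0` to `v`, then `T` rounds of "`O`, then `U (j+1)`" — the final state of a `T`-query
algorithm with unitaries `U 0, …, U T` (as `QQueryAlg.finalState`, but `ℕ`-indexed). [cite: BealsEtAl2001, §2] -/
def run (T : ℕ) (U : ℕ → Matrix S S ℂ) (O : Matrix S S ℂ) (v : S → ℂ) : S → ℂ :=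
  Fin.foldl T (fun ψ (j : Fin T) => U (j.1 + 1) *ᵥ (O *ᵥ ψ)) (U 0 *ᵥ v)

/-- No query: `run 0 U O v = U 0 v`. [folklore] -/
theorem run_zero (U : ℕ → Matrix S S ℂ) (O : Matrix S S ℂ) (v : S → ℂ) : run 0 U O v = U 0 *ᵥ v := by
  simp [run]

/-- One more round. [folklore] -/
theorem run_succ (T : ℕ) (U : ℕ → Matrix S S ℂ) (O : Matrix S S ℂ) (v : S → ℂ) :
    run (T + 1) U O v = U (T + 1) *ᵥ (O *ᵥ run T U O v) := by
  unfold run; rw [Fin.foldl_succ_last]; rfl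

/-- `run T` only reads `U 0, …, U T`. [folklore] -/
theorem run_congr {T : ℕ} {U U' : ℕ → Matrix S S ℂ} (h : ∀ j ≤ T, U' j = U j) (O : Matrix S S ℂ) (v : S → ℂ) :
    run T U' O v = run T U O v := by
  induction T with
  | zero => rw [run_zero, run_zero, h 0 le_rfl]
  | succ T ih => rw [run_succ, run_succ, h (T + 1) le_rfl, ih (fun j hj => h j (Nat.le_succ_of_le hj))]

/-- Multiplying the LAST unitary on the left multiplies the final state. [folklore] -/
theorem run_last_mul {T : ℕ} {U U' : ℕ → Matrix S S ℂ} (M : Matrix S S ℂ) (hlt : ∀ j < T, U' j = U j)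
    (hT : U' T = M * U T) (O : Matrix S S ℂ) (v : S → ℂ) : run T U' O v = M *ᵥ run T U O v := by
  cases T with
  | zero => rw [run_zero, run_zero, hT, Matrix.mulVec_mulVec]
  | succ T => rw [run_succ, run_succ, hT, run_congr (fun j hj => hlt j (Nat.lt_succ_of_le hj))]
              simp only [Matrix.mulVec_mulVec, Matrix.mul_assoc]

/-- Appending a query and a new last unitary. [folklore] -/
theorem run_succ_of {T : ℕ} {U U' : ℕ → Matrix S S ℂ} (M : Matrix S S ℂ) (hle : ∀ j ≤ T, U' j = U j)
    (hT : U' (T + 1) = M) (O : Matrix S S ℂ) (v : S → ℂ) :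
    run (T + 1) U' O v = M *ᵥ (O *ᵥ run T U O v) := by
  rw [run_succ, hT, run_congr hle]

/-- A permutation matrix is unitary. [folklore] -/
theorem permMatrix_mem_unitaryGroup [DecidableEq S] (σ : Equiv.Perm S) : σ.permMatrix ℂ ∈ Matrix.unitaryGroup S ℂ := by
  rw [Matrix.mem_unitaryGroup_iff, star_eq_conjTranspose, conjTranspose_permMatrix, Equiv.Perm.inv_def,
    Equiv.Perm.permMatrix, Equiv.Perm.permMatrix, ← PEquiv.toMatrix_trans, ← Equiv.toPEquiv_trans,
    Equiv.self_trans_symm, Equiv.toPEquiv_refl, PEquiv.toMatrix_refl]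

end Run

/-! ### The basis, the embedding, the gadgets -/

variable {G : QGateSet} {Wd N : ℕ}

/-- The basis of the simulating query algorithm: index register, target qubit, the circuit's `Wd` wires. -/
abbrev Basis (N Wd : ℕ) : Type := Fin N × Bool × QReg Wd

/-- The circuit state sits at index `i₀`, target `false`. [cite: BernsteinVazirani1997, §8] -/
def emb (i₀ : Fin N) (y : QReg Wd) : Basis N Wd := (i₀, false, y)

/-- The embedding is injective. [folklore] -/
theorem emb_injective (i₀ : Fin N) : Function.Injective (emb (Wd := Wd) i₀) := fun y y' h => by
  simpa [emb] using h

/-- The lifted vector: the circuit amplitude on the embedded copy, zero elsewhere. [folklore] -/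
theorem lift_apply (i₀ : Fin N) (ψ : QReg Wd → ℂ) (i : Fin N) (b : Bool) (y : QReg Wd) :
    lift (emb i₀) (emb_injective i₀) ψ (i, b, y) = if i = i₀ ∧ b = false then ψ y else 0 := by
  split_ifs with h
  · obtain ⟨rfl, rfl⟩ := h
    exact lift_e (emb i) (emb_injective i) ψ y
  · refine lift_of_not_mem _ _ ψ ?_
    rintro ⟨y', h'⟩
    simp only [emb, Prod.mk.injEq] at h'
    exact h ⟨h'.1.symm, h'.2.1.symm⟩

/-- An oracle-free gate: its placement, on the embedded copy (identity elsewhere). [cite: NielsenChuang2010, §4.3] -/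
def gateU (hG : G.IsUnitary) (i₀ : Fin N) (g : G.Op) (e : Fin (G.arity g) ↪ Fin Wd) :
    Matrix.unitaryGroup (Basis N Wd) ℂ :=
  extU (emb i₀) (emb_injective i₀) ⟨placeGate e (G.mat g), placeGate_mem_unitaryGroup_holds e (hG g)⟩

section OracleGadget
variable (i₀ : Fin N) (adr : OracleVar Wd → Fin N) {k : ℕ} (e : Fin (k + 1) ↪ Fin Wd)

/-- The input position addressed by the query wires of `y`. [cite: AaronsonAmbainis2014, proof of Thm. 23 (the bits of B)] -/
def idx (y : QReg Wd) : Fin N := adr ⟨queryOf e y, mem_shortStrings.2 (length_queryOf_lt e y)⟩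

/-- The query string does not depend on the answer wire. [folklore] -/
theorem queryOf_update_last (y : QReg Wd) (c : Bool) : queryOf e (Function.update y (e (Fin.last k)) c) = queryOf e y := by
  unfold queryOf; exact List.ofFn_inj.2 (funext fun i => Function.update_of_ne (castSucc_ne_last_wire e i) _ _)

/-- … hence neither does the addressed position. [folklore] -/
theorem idx_update_last (y : QReg Wd) (c : Bool) : idx adr e (Function.update y (e (Fin.last k)) c) = idx adr e y := by
  unfold idx; congr 2; exact queryOf_update_last e y c

/-- Swap the target qubit with the answer wire `τ = e k`: `(i, b, y) ↦ (i, y τ, y[τ := b])`. [folklore] -/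
def swapMap (s : Basis N Wd) : Basis N Wd :=
  (s.1, s.2.2 (e (Fin.last k)), Function.update s.2.2 (e (Fin.last k)) s.2.1)

/-- `swapMap` is an involution. [folklore] -/
theorem swapMap_involutive : Function.Involutive (swapMap (N := N) e) := by
  rintro ⟨i, b, y⟩; simp [swapMap]

/-- Load the address: `(i, b, y) ↦ (swap i₀ (idx y) i, b, y)`. [folklore] -/
def adrMap (s : Basis N Wd) : Basis N Wd := (Equiv.swap i₀ (idx adr e s.2.2) s.1, s.2.1, s.2.2)

/-- `adrMap` is an involution. [folklore] -/
theorem adrMap_involutive : Function.Involutive (adrMap (Wd := Wd) i₀ adr e) := by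
  rintro ⟨i, b, y⟩; simp [adrMap, Equiv.swap_apply_self]

/-- The swap gadget as a unitary (a permutation matrix). [folklore] -/
def swapU : Matrix.unitaryGroup (Basis N Wd) ℂ :=
  ⟨(swapMap_involutive (N := N) e).toPerm.permMatrix ℂ, permMatrix_mem_unitaryGroup _⟩

/-- The address gadget as a unitary (a permutation matrix). [folklore] -/
def adrU : Matrix.unitaryGroup (Basis N Wd) ℂ :=
  ⟨(adrMap_involutive i₀ adr e).toPerm.permMatrix ℂ, permMatrix_mem_unitaryGroup _⟩

/-- **An oracle gate is a conjugated query.**  For an oracle `A` compatible with the input `t` along `adr`: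
`adr·swap · O_t · swap·adr` acts on an embedded state as the placed oracle gate of `A`.
[cite: BernsteinVazirani1997, §8] -/
theorem oracle_conj (A : Language Bool) (t : Fin N → Bool) (hA : ∀ q : OracleVar Wd, A.boolIndicator q.1 = t (adr q))
    (ψ : QReg Wd → ℂ) :
    ((adrU i₀ adr e * swapU e : Matrix.unitaryGroup (Basis N Wd) ℂ) : Matrix (Basis N Wd) (Basis N Wd) ℂ) *ᵥ
        (queryOracle t *ᵥ (((swapU e * adrU i₀ adr e : Matrix.unitaryGroup (Basis N Wd) ℂ) :
          Matrix (Basis N Wd) (Basis N Wd) ℂ) *ᵥ lift (emb i₀) (emb_injective i₀) ψ)) =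
      lift (emb i₀) (emb_injective i₀) (placeGate e (oracleGate A k) *ᵥ ψ) := by
  set τ := e (Fin.last k) with hτ
  have hmul1 : ((adrU i₀ adr e * swapU e : Matrix.unitaryGroup (Basis N Wd) ℂ) : Matrix (Basis N Wd) (Basis N Wd) ℂ) =
      (adrMap_involutive i₀ adr e).toPerm.permMatrix ℂ * (swapMap_involutive (N := N) e).toPerm.permMatrix ℂ := rfl
  have hmul2 : ((swapU e * adrU i₀ adr e : Matrix.unitaryGroup (Basis N Wd) ℂ) : Matrix (Basis N Wd) (Basis N Wd) ℂ) =
      (swapMap_involutive (N := N) e).toPerm.permMatrix ℂ * (adrMap_involutive i₀ adr e).toPerm.permMatrix ℂ := rfl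
  rw [hmul1, hmul2, ← Matrix.mulVec_mulVec, ← Matrix.mulVec_mulVec]
  funext ⟨i, b, y⟩
  simp only [Matrix.permMatrix_mulVec, Function.comp_apply, Function.Involutive.coe_toPerm, queryOracle_mulVec_apply]
  set i' : Fin N := Equiv.swap i₀ (idx adr e y) i with hi'
  have h1 : adrMap i₀ adr e (i, b, y) = (i', b, y) := rfl
  have h2 : swapMap (N := N) e (i', b, y) = (i', y τ, Function.update y τ b) := rfl
  have h4 : swapMap (N := N) e (i', (y τ ^^ t i'), Function.update y τ b) = (i', b, Function.update y τ (y τ ^^ t i')) := by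
    simp [swapMap, hτ]
  have h5 : adrMap i₀ adr e (i', b, Function.update y τ (y τ ^^ t i')) = (i, b, Function.update y τ (y τ ^^ t i')) := by
    simp only [adrMap, hτ, idx_update_last, hi', Equiv.swap_apply_self]
  rw [h1, h2]
  simp only []
  rw [h4, h5, lift_apply, lift_apply]
  split_ifs with h
  · obtain ⟨rfl, rfl⟩ := h
    rw [placeGate_oracleGate_mulVec_apply]
    unfold oracleTarget
    rw [hA ⟨queryOf e y, mem_shortStrings.2 (length_queryOf_lt e y)⟩, hi', Equiv.swap_apply_left]; rfl
  · rfl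

end OracleGadget

/-! ### The program of a gate list and its invariant -/

/-- An `ℕ`-indexed program: `T` queries and unitaries `U 0, …, U T` (values beyond `T` are irrelevant). -/
structure Prog (N Wd : ℕ) where
  /-- number of queries so far -/
  T : ℕ
  /-- the unitaries between the queries -/
  U : ℕ → Matrix.unitaryGroup (Basis N Wd) ℂ

/-- One more gate at the END of the circuit: an oracle-free gate multiplies the last unitary; an oracle gate
multiplies the last unitary by `swap·adr`, adds a query, and starts the new last unitary with `adr·swap`.
[cite: BernsteinVazirani1997, §8] -/
def Prog.step (hG : G.IsUnitary) (i₀ : Fin N) (adr : OracleVar Wd → Fin N) (P : Prog N Wd) : QGate G Wd → Prog N Wd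
  | .gate g e => ⟨P.T, Function.update P.U P.T (gateU hG i₀ g e * P.U P.T)⟩
  | .oracle _ e => ⟨P.T + 1,
      Function.update (Function.update P.U P.T (swapU e * adrU i₀ adr e * P.U P.T)) (P.T + 1) (adrU i₀ adr e * swapU e)⟩

/-- The program of a gate list (head of the list = first gate applied). [cite: BernsteinVazirani1997, §8] -/
def progOf (hG : G.IsUnitary) (i₀ : Fin N) (adr : OracleVar Wd → Fin N) (gs : List (QGate G Wd)) : Prog N Wd :=
  gs.foldl (Prog.step hG i₀ adr) ⟨0, fun _ => 1⟩

/-- `foldl` unrolled at the end. [folklore] -/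
theorem progOf_concat (hG : G.IsUnitary) (i₀ : Fin N) (adr : OracleVar Wd → Fin N) (gs : List (QGate G Wd)) (g : QGate G Wd) :
    progOf hG i₀ adr (gs ++ [g]) = (progOf hG i₀ adr gs).step hG i₀ adr g := by
  simp [progOf, List.foldl_append]

/-- The matrix of a circuit with one more gate at the end. [folklore] -/
theorem toMatrix_concat (A : Language Bool) (gs : List (QGate G Wd)) (g : QGate G Wd) :
    (⟨gs ++ [g]⟩ : QCircuit G Wd).toMatrix A = g.toMatrix A * (⟨gs⟩ : QCircuit G Wd).toMatrix A := by
  simp [QCircuit.toMatrix, List.map_append, List.reverse_append]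

/-- An oracle-free gate at the end does not change the number of oracle queries. [folklore] -/
theorem oracleQueries_concat_gate (gs : List (QGate G Wd)) (g : G.Op) (e : Fin (G.arity g) ↪ Fin Wd) :
    (⟨gs ++ [QGate.gate g e]⟩ : QCircuit G Wd).oracleQueries = (⟨gs⟩ : QCircuit G Wd).oracleQueries := by
  simp [QCircuit.oracleQueries, List.filter_append, QGate.IsOracleFree]

/-- An oracle gate at the end adds one oracle query. [folklore] -/
theorem oracleQueries_concat_oracle (gs : List (QGate G Wd)) (k : ℕ) (e : Fin (k + 1) ↪ Fin Wd) :
    (⟨gs ++ [QGate.oracle k e]⟩ : QCircuit G Wd).oracleQueries = (⟨gs⟩ : QCircuit G Wd).oracleQueries + 1 := by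
  simp [QCircuit.oracleQueries, List.filter_append, QGate.IsOracleFree]

section Invariant
variable {hG : G.IsUnitary} (i₀ : Fin N) (adr : OracleVar Wd → Fin N) (A : Language Bool) (t : Fin N → Bool)
  (hA : ∀ q : OracleVar Wd, A.boolIndicator q.1 = t (adr q)) (y₀ : QReg Wd)

/-- **The invariant**: the program of `gs` makes `#oracle gates` queries and its final state on input `t` is the
embedded state of the circuit `gs` run on `|y₀⟩` relative to the compatible oracle `A`. [cite: BernsteinVazirani1997, §8] -/
structure Inv (P : Prog N Wd) (gs : List (QGate G Wd)) : Prop where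
  /-- the program makes as many queries as the circuit has oracle gates -/
  queries_eq : P.T = (⟨gs⟩ : QCircuit G Wd).oracleQueries
  /-- the program's final state is the embedded circuit state -/
  run_eq : run P.T (fun j => (P.U j : Matrix (Basis N Wd) (Basis N Wd) ℂ)) (queryOracle t) (Pi.single (emb i₀ y₀) 1) =
      lift (emb i₀) (emb_injective i₀) ((⟨gs⟩ : QCircuit G Wd).toMatrix A *ᵥ Pi.single y₀ 1)

/-- The empty program satisfies the invariant for the empty circuit. [folklore] -/
theorem inv_nil : Inv i₀ A t y₀ ⟨0, fun _ => 1⟩ ([] : List (QGate G Wd)) := by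
  refine ⟨rfl, ?_⟩
  simp only [run_zero, QCircuit.toMatrix_nil, Matrix.one_mulVec]
  rw [show ((1 : Matrix.unitaryGroup (Basis N Wd) ℂ) : Matrix (Basis N Wd) (Basis N Wd) ℂ) = 1 from rfl,
    Matrix.one_mulVec, lift_single]

include hA in
/-- One step preserves the invariant. [cite: BernsteinVazirani1997, §8] -/
theorem inv_step {P : Prog N Wd} {gs : List (QGate G Wd)} (h : Inv i₀ A t y₀ P gs) (g : QGate G Wd) :
    Inv i₀ A t y₀ (P.step hG i₀ adr g) (gs ++ [g]) := by
  obtain ⟨hT, hrun⟩ := h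
  cases g with
  | gate g e =>
    refine ⟨by rw [oracleQueries_concat_gate]; exact hT, ?_⟩
    show run P.T (fun j => ((Function.update P.U P.T (gateU hG i₀ g e * P.U P.T) j : Matrix.unitaryGroup (Basis N Wd) ℂ) :
        Matrix (Basis N Wd) (Basis N Wd) ℂ)) (queryOracle t) (Pi.single (emb i₀ y₀) 1) = _
    rw [run_last_mul (U := fun j => (P.U j : Matrix (Basis N Wd) (Basis N Wd) ℂ))
        ((gateU hG i₀ g e : Matrix.unitaryGroup (Basis N Wd) ℂ) : Matrix (Basis N Wd) (Basis N Wd) ℂ)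
        (fun j hj => by simp [Function.update_of_ne (Nat.ne_of_lt hj)])
        (by simp), hrun, toMatrix_concat, ← Matrix.mulVec_mulVec, QGate.toMatrix_gate]
    exact extMatrix_mulVec_lift (emb i₀) (emb_injective i₀) _ _
  | oracle k e =>
    refine ⟨by rw [oracleQueries_concat_oracle]; exact congrArg (· + 1) hT, ?_⟩
    show run (P.T + 1) (fun j => ((Function.update (Function.update P.U P.T (swapU e * adrU i₀ adr e * P.U P.T)) (P.T + 1)
        (adrU i₀ adr e * swapU e) j : Matrix.unitaryGroup (Basis N Wd) ℂ) : Matrix (Basis N Wd) (Basis N Wd) ℂ))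
        (queryOracle t) (Pi.single (emb i₀ y₀) 1) = _
    rw [run_succ_of (U := fun j => ((Function.update P.U P.T (swapU e * adrU i₀ adr e * P.U P.T) j :
          Matrix.unitaryGroup (Basis N Wd) ℂ) : Matrix (Basis N Wd) (Basis N Wd) ℂ))
        ((adrU i₀ adr e * swapU e : Matrix.unitaryGroup (Basis N Wd) ℂ) : Matrix (Basis N Wd) (Basis N Wd) ℂ)
        (fun j hj => by simp [Function.update_of_ne (Nat.ne_of_lt (Nat.lt_succ_of_le hj))])
        (by simp),
      run_last_mul (U := fun j => (P.U j : Matrix (Basis N Wd) (Basis N Wd) ℂ))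
        ((swapU e * adrU i₀ adr e : Matrix.unitaryGroup (Basis N Wd) ℂ) : Matrix (Basis N Wd) (Basis N Wd) ℂ)
        (fun j hj => by simp [Function.update_of_ne (Nat.ne_of_lt hj)])
        (by simp [mul_assoc]),
      hrun, oracle_conj i₀ adr e A t hA, toMatrix_concat, ← Matrix.mulVec_mulVec, QGate.toMatrix_oracle]

include hA in
/-- Folding the steps preserves the invariant. [folklore] -/
theorem inv_foldl (gs : List (QGate G Wd)) : ∀ {P : Prog N Wd} {gs₀ : List (QGate G Wd)},
    Inv i₀ A t y₀ P gs₀ → Inv i₀ A t y₀ (gs.foldl (Prog.step hG i₀ adr) P) (gs₀ ++ gs) := by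
  induction gs with
  | nil => intro P gs₀ h; simpa using h
  | cons g gs ih =>
    intro P gs₀ h; rw [List.foldl_cons, ← List.singleton_append, ← List.append_assoc]
    exact ih (inv_step i₀ adr A t hA y₀ h g)

include hA in
/-- **The program of `gs` satisfies the invariant.** [cite: BernsteinVazirani1997, §8] -/
theorem inv_progOf (gs : List (QGate G Wd)) : Inv i₀ A t y₀ (progOf hG i₀ adr gs) gs := by
  have h := inv_foldl (hG := hG) i₀ adr A t hA y₀ gs (inv_nil i₀ A t y₀)
  rwa [List.nil_append] at h

end Invariant

/-! ### The query algorithm of a circuit -/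

/-- **The quantum query algorithm of an oracle circuit** (gate list `gs` on `Wd` wires, run on `|y₀⟩`, oracle strings
addressed by `adr`): workspace = the circuit's wires, queries = `#oracle gates`, accepting = wire `0` reads `true`.
(`reducible`: its workspace `QReg Wd` and instances must unfold for rewriting.) [cite: BernsteinVazirani1997, §8] -/
@[reducible] def circuitAlg (hG : G.IsUnitary) (i₀ : Fin N) (adr : OracleVar Wd → Fin N) (gs : List (QGate G Wd)) (y₀ : QReg Wd) :
    QQueryAlg N where
  W := QReg Wd
  queries := (progOf hG i₀ adr gs).T
  unitaries := fun j => (progOf hG i₀ adr gs).U j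
  start := emb i₀ y₀
  accept := emb i₀ '' QCircuit.acceptEvent Wd

/-- **Queries = oracle gates.** [cite: AaronsonAmbainis2014, proof of Thm. 23] -/
theorem circuitAlg_queries (hG : G.IsUnitary) (i₀ : Fin N) (adr : OracleVar Wd → Fin N) (gs : List (QGate G Wd)) (y₀ : QReg Wd) :
    (circuitAlg hG i₀ adr gs y₀).queries = (⟨gs⟩ : QCircuit G Wd).oracleQueries :=
  (inv_progOf (hG := hG) i₀ adr (0 : Language Bool) (fun _ => false)
    (fun q => (Set.notMem_iff_boolIndicator _ _).1 (Language.notMem_zero q.1)) y₀ gs).1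

/-- The final state of the query algorithm is the program's `run`. [folklore] -/
theorem circuitAlg_finalState (hG : G.IsUnitary) (i₀ : Fin N) (adr : OracleVar Wd → Fin N) (gs : List (QGate G Wd))
    (y₀ : QReg Wd) (t : Fin N → Bool) :
    (circuitAlg hG i₀ adr gs y₀).finalState t =
      run (progOf hG i₀ adr gs).T (fun j => ((progOf hG i₀ adr gs).U j : Matrix (Basis N Wd) (Basis N Wd) ℂ))
        (queryOracle t) (Pi.single (emb i₀ y₀) 1) := rfl

/-- **Equal acceptance probabilities** (oracle `A` compatible with the input `t` along `adr`): the query algorithm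
of the circuit accepts `t` with the Born probability that wire `0` of the circuit run on `|y₀⟩` relative to `A`
reads `true`. [cite: BernsteinVazirani1997, §8] -/
theorem circuitAlg_acceptProb (hG : G.IsUnitary) (i₀ : Fin N) (adr : OracleVar Wd → Fin N) (gs : List (QGate G Wd))
    (y₀ : QReg Wd) (A : Language Bool) (t : Fin N → Bool) (hA : ∀ q : OracleVar Wd, A.boolIndicator q.1 = t (adr q)) :
    (circuitAlg hG i₀ adr gs y₀).acceptProb t =
      QCircuit.probEvent A ⟨gs⟩ (basisState y₀) (QCircuit.acceptEvent Wd) := by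
  classical
  unfold QQueryAlg.acceptProb QCircuit.probEvent QCircuit.runOn
  rw [circuitAlg_finalState, (inv_progOf (hG := hG) i₀ adr A t hA y₀ gs).2]
  have hacc : (circuitAlg hG i₀ adr gs y₀).accept = emb i₀ '' QCircuit.acceptEvent Wd := rfl
  symm
  refine Finset.sum_nbij (emb i₀) (fun s hs => ?_) (fun s _ s' _ h => emb_injective i₀ h)
    (fun x hx => ?_) (fun s _ => by rw [lift_e]; rfl)
  · rw [Finset.mem_filter] at hs ⊢
    exact ⟨Finset.mem_univ _, hacc ▸ Set.mem_image_of_mem _ hs.2⟩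
  · rw [Finset.mem_coe, Finset.mem_filter, hacc] at hx
    obtain ⟨s, hs, rfl⟩ := hx.2
    exact ⟨s, by rw [Finset.mem_coe, Finset.mem_filter]; exact ⟨Finset.mem_univ _, hs⟩, rfl⟩

/-- **Circuit form**: for a circuit `C` on `n + m` wires and input `x` on the first `n` wires, the query algorithm of
`C` run on `|x⟩|0^m⟩` has acceptance probability `C.acceptProb A x` on every compatible input. [cite: BernsteinVazirani1997, §8] -/
theorem circuitAlg_acceptProb_circuit (hG : G.IsUnitary) {n m : ℕ} (C : QCircuit G (n + m)) (x : QReg n) (i₀ : Fin N)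
    (adr : OracleVar (n + m) → Fin N) (A : Language Bool) (t : Fin N → Bool)
    (hA : ∀ q : OracleVar (n + m), A.boolIndicator q.1 = t (adr q)) :
    (circuitAlg hG i₀ adr C.gates (padInput x m)).acceptProb t = C.acceptProb A x := by
  rw [circuitAlg_acceptProb hG i₀ adr C.gates (padInput x m) A t hA, QCircuit.acceptProb_eq_probEvent]

/-! ### Circuit families: the query algorithm behind `acceptPoly F x` -/

section Family
variable (F : QCircuitFamily G) (x : List Bool)

/-- **The query algorithm of the run of `F` on `x`** over the `M = numOracleBits F x` relevant oracle bits (enumerated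
by `bitEquiv F x`). [cite: AaronsonAmbainis2014, proof of Thm. 23 (p. 14)] -/
@[reducible] def familyAlg (hG : G.IsUnitary) (F : QCircuitFamily G) (x : List Bool) (hN : 0 < numOracleBits F x) :
    QQueryAlg (numOracleBits F x) :=
  circuitAlg hG ⟨0, hN⟩ (bitEquiv F x) (F.circ x.length).gates (padInput x.get (F.ancillas x.length))

/-- It makes exactly `(F.circ |x|).oracleQueries` queries. [cite: AaronsonAmbainis2014, proof of Thm. 23 (p. 14)] -/
theorem familyAlg_queries (hG : G.IsUnitary) (hN : 0 < numOracleBits F x) :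
    (familyAlg hG F x hN).queries = (F.circ x.length).oracleQueries :=
  circuitAlg_queries hG _ _ _ _

/-- The oracle with prescribed relevant bits is compatible with those bits along `bitEquiv`. [folklore] -/
theorem boolIndicator_oracleOf (b : Fin (numOracleBits F x) → Bool) (q : OracleVar (oracleWidth F x)) :
    (oracleOf F x b).boolIndicator q.1 = b (bitEquiv F x q) := by
  apply Bool.eq_iff_iff.2
  rw [← Set.mem_iff_boolIndicator]
  unfold oracleOf
  simp only [Set.mem_setOf_eq]
  exact ⟨fun ⟨_, hb⟩ => hb, fun hb => ⟨q.2, hb⟩⟩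

/-- **`acceptPoly F x` is a quantum QUERY acceptance probability**: on every point `b` of the cube,
`acceptProb (familyAlg F x) b = evalBool (acceptPoly F x) b` (`= F.acceptProbOn (oracleOf F x b) x`).
[cite: AaronsonAmbainis2014, Lemma 20 and proof of Thm. 23 (p. 14)] -/
theorem familyAlg_acceptProb (hG : G.IsUnitary) (hN : 0 < numOracleBits F x) (b : Fin (numOracleBits F x) → Bool) :
    (familyAlg hG F x hN).acceptProb b = evalBool (acceptPoly F x) b := by
  have h := circuitAlg_acceptProb_circuit hG (F.circ x.length) x.get ⟨0, hN⟩ (bitEquiv F x) (oracleOf F x b) b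
    (boolIndicator_oracleOf F x b)
  rw [← oracleBits_oracleOf F x b, evalBool_acceptPoly, oracleBits_oracleOf]
  exact h

/-- Existence form: some query algorithm with `#oracle gates` queries has `acceptPoly F x` as its acceptance
probability on the cube. [cite: AaronsonAmbainis2014, Lemma 20 and proof of Thm. 23 (p. 14)] -/
theorem exists_queryAlg_acceptPoly (hG : G.IsUnitary) (hN : 0 < numOracleBits F x) :
    ∃ Q : QQueryAlg (numOracleBits F x), Q.queries = (F.circ x.length).oracleQueries ∧
      ∀ b, evalBool (acceptPoly F x) b = Q.acceptProb b :=
  ⟨familyAlg hG F x hN, familyAlg_queries F x hG hN, fun b => (familyAlg_acceptProb F x hG hN b).symm⟩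

end Family

end Summit.QuantumAdvantage.QuantumAdvantage.Theorems.SosSandwich.CircuitToQuery
end
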